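import Mathlib
import HarnessLib
import Summits.QuantumFields.YangMills.Theorems.HypercubicLimit.Negative.TruncatedOSForm

/-!
# `CurvatureKernelBound` — reflection positivity PROPAGATES the vanishing of the truncated two-point function
# from far-separated to all axial ball pairs (support for stmt-QuantumFields-11687, line `coupling-trichotomy`, lead c9)

Crux `stmt-QuantumFields-11687` (`PencilRigidity.CurvatureKernelBound`), child 2a `Stub.FiniteCouplingStrongTempered`.
On the strong-coupling disc the lattice clustering kills the truncated two-point function of the continuum limit `S₁`
only on axial ball pairs that are FAR apart (separation `> δ₀/m` for a tempered renormalisation); this file supplies the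
continuum half: for a one-species family with E2, translation invariance on `⁰𝒮` and `𝔖₀ = 1`, vanishing of the
truncated two-point function on far axial pairs implies vanishing on ALL axial pairs `B̄(∓s e₀, ρ)`, `ρ ≤ s/2`.

Mechanism (OS Hilbert space of the tree's `OSReconstructionNoE1`; truncated OS form = Gram form of the vacuum-subtracted
field vectors `χ_w = Ψ_w − ⟨Ω,Ψ_w⟩Ω`, `TruncatedOSForm.osTrunc_eq_inner`):
* `transfer_eq_zero_of_inner_transfer_eq_zero` — **halving**: `⟪ψ, e^{−t₀H}ψ⟫ = ‖e^{−t₀H/2}ψ‖²`, so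
  `⟪ψ, e^{−t₀H}ψ⟫ = 0` forces `e^{−t₀H/2^{n}}ψ = 0` for all `n ≥ 1`, hence `e^{−tH}ψ = 0` for every `t > 0` (semigroup law);
* `transfer_chi` — `e^{−tH} χ_w = χ_{w(· − t e₀)}` (`e^{−tH}Ω = Ω`, symmetry of `e^{−tH}`; no definition is introduced);
* `osTrunc_timeShift_eq_zero` — if `T(w, w_{t₀}) = 0` for ONE `t₀ > 0` then `T(u, w_t) = 0` for all `t > 0` and all `u`;
* `osTrunc_eq_zero_of_far` — ball form: far vanishing (two times `s₁, s₂`, common radius) ⇒ vanishing on `B̄(s e₀, ρ)²`;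
* `TruncatedAxialPropagation` — the two-point (`⁰𝒮`, real tensors) form consumed by the assembly, via translation invariance.
[OsterwalderSchrader1973 §4.1; GlimmJaffe1987 Thm. 6.1.3; folklore]
-/

noncomputable section

open scoped SchwartzMap ComplexConjugate InnerProductSpace
open MeasureTheory Filter Topology Complex Set Metric
open Literature.MathematicalPhysics.AQFT Literature.MathematicalPhysics.QuantumLattice
open Literature.MathematicalPhysics.QuantumFieldTheory
open Literature.MathematicalPhysics.QuantumLattice.SchwingerFamily (timeVec)
open Summit.QuantumFields.YangMills.Theorems.HypercubicLimit.Negative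

namespace Summit.QuantumFields.YangMills.Theorems.CurvatureKernel

namespace AxialPropagation

/-! ## Halving in the OS Hilbert space -/

section Hilbert

universe u

variable {ι : Type u} {d : ℕ} [NeZero d] {S : LabelledSchwingerFamily ι (EuclideanSpace ℝ (Fin d))}
  (h : OSReconstructionNoE1 S)

/-- **Halving**: `⟪ψ, e^{−tH}ψ⟫ = 0` with `t ≥ 0` forces `e^{−tH/2}ψ = 0`. [folklore] -/
theorem transfer_half_eq_zero {t : ℝ} (ht : 0 ≤ t) {ψ : h.Hilbert}
    (h0 : ⟪ψ, h.transfer t ψ⟫_ℂ = 0) : h.transfer (t / 2) ψ = 0 := by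
  have h1 := h.inner_transfer_self_eq ht ψ
  rw [h0] at h1
  have h2 : ‖h.transfer (t / 2) ψ‖ ^ 2 = 0 := by exact_mod_cast h1.symm
  exact norm_eq_zero.1 (pow_eq_zero_iff two_ne_zero |>.1 h2)

/-- Iterated halving: `e^{−(t/2^{n+1})H}ψ = 0` for all `n`. [folklore] -/
theorem transfer_div_two_pow_eq_zero {t : ℝ} (ht : 0 ≤ t) {ψ : h.Hilbert}
    (h0 : ⟪ψ, h.transfer t ψ⟫_ℂ = 0) (n : ℕ) : h.transfer (t / 2 ^ (n + 1)) ψ = 0 := by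
  induction n with
  | zero => simpa using transfer_half_eq_zero h ht h0
  | succ n ih =>
    have h1 : ⟪ψ, h.transfer (t / 2 ^ (n + 1)) ψ⟫_ℂ = 0 := by rw [ih, inner_zero_right]
    have h2 := transfer_half_eq_zero h (by positivity) h1
    have h3 : t / 2 ^ (n + 1) / 2 = t / 2 ^ (n + 1 + 1) := by rw [div_div, ← pow_succ]
    rwa [h3] at h2

/-- **Propagation of a null transfer**: if `⟪ψ, e^{−t₀H}ψ⟫ = 0` for one `t₀ > 0`, then `e^{−tH}ψ = 0` for every
`t > 0` (halving + the semigroup law). [folklore] -/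
theorem transfer_eq_zero_of_inner_transfer_eq_zero {t₀ : ℝ} (ht₀ : 0 < t₀) {ψ : h.Hilbert}
    (h0 : ⟪ψ, h.transfer t₀ ψ⟫_ℂ = 0) {t : ℝ} (ht : 0 < t) : h.transfer t ψ = 0 := by
  -- a dyadic fraction of `t₀` below `t`
  obtain ⟨n, hn⟩ : ∃ n : ℕ, t₀ / 2 ^ (n + 1) ≤ t := by
    obtain ⟨n, hn⟩ := exists_nat_gt (t₀ / t)
    refine ⟨n, ?_⟩
    have h2 : (n : ℝ) < 2 ^ (n + 1) := by
      have := Nat.lt_two_pow_self (n := n)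
      calc (n : ℝ) < (2 ^ n : ℕ) := by exact_mod_cast this
        _ ≤ 2 ^ (n + 1) := by push_cast; exact pow_le_pow_right₀ one_le_two (Nat.le_succ n)
    rw [div_le_iff₀ (by positivity)]
    rw [div_lt_iff₀ ht] at hn
    nlinarith
  set s : ℝ := t₀ / 2 ^ (n + 1) with hs
  have hs0 : 0 ≤ s := by positivity
  have hts : 0 ≤ t - s := sub_nonneg.2 hn
  have e : t = (t - s) + s := by ring
  rw [e, h.transfer_add hts hs0, ContinuousLinearMap.comp_apply, hs,
    transfer_div_two_pow_eq_zero h ht₀.le h0 n, map_zero]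

end Hilbert

/-! ## Real positive-time one-point functions: time shifts, field vectors, vacuum subtraction -/

section OSForm

variable {ι : Type} {S : LabelledSchwingerFamily ι (EuclideanSpace ℝ (Fin 4))}
  (h : OSReconstructionNoE1 S) (lab : ι)

/-- Support of a time shift: `supp w(· − t e₀) ⊆ supp w + t e₀`, so positive-time functions stay positive-time for
`t ≥ 0`. [folklore] -/
theorem tsupport_timeShiftTest_pos {w : 𝓢((EuclideanSpace ℝ (Fin 4)), ℝ)}
    (hw : tsupport w ⊆ {y : (EuclideanSpace ℝ (Fin 4)) | 0 < y 0}) {t : ℝ} (ht : 0 ≤ t) :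
    tsupport (timeShiftTest 4 t w) ⊆ {y : (EuclideanSpace ℝ (Fin 4)) | 0 < y 0} := by
  intro y hy
  have hK : IsClosed ((fun y : EuclideanSpace ℝ (Fin 4) => y - EuclideanSpace.single 0 t) ⁻¹' tsupport w) :=
    (isClosed_tsupport _).preimage (continuous_id.sub continuous_const)
  have hsub : Function.support (timeShiftTest 4 t w) ⊆
      (fun y : EuclideanSpace ℝ (Fin 4) => y - EuclideanSpace.single 0 t) ⁻¹' tsupport w := by
    intro z hz
    rw [Function.mem_support, timeShiftTest_apply] at hz
    exact subset_tsupport _ (Function.mem_support.2 hz)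
  have h1 := hw (closure_minimal hsub hK hy)
  simp only [mem_setOf_eq, PiLp.sub_apply, PiLp.single_apply, if_true, sub_pos] at h1
  exact lt_of_le_of_lt ht h1

/-- Time shifts compose additively on real one-point functions. [folklore] -/
theorem timeShiftTest_timeShiftTest (s t : ℝ) (w : 𝓢((EuclideanSpace ℝ (Fin 4)), ℝ)) :
    timeShiftTest 4 s (timeShiftTest 4 t w) = timeShiftTest 4 (s + t) w := by
  ext x
  simp only [timeShiftTest_apply]
  congr 1
  ext i
  simp only [PiLp.sub_apply, PiLp.single_apply]
  split_ifs <;> ring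

/-- `w(· − 0) = w`. [folklore] -/
theorem timeShiftTest_zero' (w : 𝓢((EuclideanSpace ℝ (Fin 4)), ℝ)) : timeShiftTest 4 0 w = w := by
  ext x
  simp only [timeShiftTest_apply]
  congr 1
  ext i
  simp

/-- The time translate of a real one-point tensor is the tensor of the time shift. [folklore] -/
theorem translateMulti_timeVec_tensor₁ (t : ℝ) (w : 𝓢((EuclideanSpace ℝ (Fin 4)), ℝ)) :
    translateMulti (timeVec t) (tensor₁ w) = tensor₁ (timeShiftTest 4 t w) := by
  ext x
  rw [translateMulti_apply, tensor₁_apply, tensor₁_apply, timeShiftTest_apply]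

/-- Field vectors of (propositionally) equal test functions agree. [folklore] -/
theorem fieldVec_congr' {n : ℕ} (k : Fin n → ι) {F G : 𝓢((Fin n → EuclideanSpace ℝ (Fin 4)), ℂ)}
    (hFG : F = G) (hF : IsTimeOrdered F) (hG : IsTimeOrdered G) :
    h.fieldVec n k F hF = h.fieldVec n k G hG := by
  subst hFG
  rfl

/-- **`e^{−tH} Ψ_w = Ψ_{w(· − t e₀)}`** for a real positive-time `w` and `t ≥ 0`. [folklore] -/
theorem transfer_psi {w : 𝓢((EuclideanSpace ℝ (Fin 4)), ℝ)}
    (hw : tsupport w ⊆ {y : (EuclideanSpace ℝ (Fin 4)) | 0 < y 0}) {t : ℝ} (ht : 0 ≤ t) :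
    h.transfer t (HypercubicLimit.Negative.psi h lab hw) =
      HypercubicLimit.Negative.psi h lab (tsupport_timeShiftTest_pos hw ht) := by
  unfold HypercubicLimit.Negative.psi
  rw [h.transfer_fieldVec ht]
  exact fieldVec_congr' h _ (translateMulti_timeVec_tensor₁ t w) _ _

/-- **`e^{−tH} χ_w = χ_{w(· − t e₀)}`** for the vacuum-subtracted field vector `χ_w = Ψ_w − ⟨Ω, Ψ_w⟩ Ω`
(`e^{−tH}Ω = Ω` and `e^{−tH}` is symmetric). [folklore] -/
theorem transfer_chi {w : 𝓢((EuclideanSpace ℝ (Fin 4)), ℝ)}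
    (hw : tsupport w ⊆ {y : (EuclideanSpace ℝ (Fin 4)) | 0 < y 0}) {t : ℝ} (ht : 0 ≤ t) :
    h.transfer t (HypercubicLimit.Negative.psi h lab hw -
        ⟪h.vacuum, HypercubicLimit.Negative.psi h lab hw⟫_ℂ • h.vacuum) =
      HypercubicLimit.Negative.psi h lab (tsupport_timeShiftTest_pos hw ht) -
        ⟪h.vacuum, HypercubicLimit.Negative.psi h lab (tsupport_timeShiftTest_pos hw ht)⟫_ℂ • h.vacuum := by
  rw [map_sub, map_smul, h.transfer_vacuum, transfer_psi h lab hw ht]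
  congr 2
  rw [← transfer_psi h lab hw ht, ← h.inner_transfer_left, h.transfer_vacuum]

/-- **Core propagation.** If the truncated OS form vanishes on the pair `(w, w(· − t₀ e₀))` for ONE `t₀ > 0`, then it
vanishes on `(u, w(· − t e₀))` for EVERY `t > 0` and every real positive-time `u`: `T(w, w_{t₀}) = ⟪χ_w, e^{−t₀H}χ_w⟫`
(`TruncatedOSForm.osTrunc_eq_inner`), so `e^{−tH}χ_w = 0` for all `t > 0`, and `T(u, w_t) = ⟪χ_u, e^{−tH}χ_w⟫`.
[folklore] -/
theorem osTrunc_timeShift_eq_zero (h : OSReconstructionNoE1 S) (lab : ι) (hN : S.IsNormalized)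
    {w : 𝓢((EuclideanSpace ℝ (Fin 4)), ℝ)}
    (hw : tsupport w ⊆ {y : (EuclideanSpace ℝ (Fin 4)) | 0 < y 0}) {t₀ : ℝ} (ht₀ : 0 < t₀)
    (h0 : osTrunc S lab w (timeShiftTest 4 t₀ w) = 0) {u : 𝓢((EuclideanSpace ℝ (Fin 4)), ℝ)}
    (hu : tsupport u ⊆ {y : (EuclideanSpace ℝ (Fin 4)) | 0 < y 0}) {t : ℝ} (ht : 0 < t) :
    osTrunc S lab u (timeShiftTest 4 t w) = 0 := by
  set χ : h.Hilbert := HypercubicLimit.Negative.psi h lab hw -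
    ⟪h.vacuum, HypercubicLimit.Negative.psi h lab hw⟫_ℂ • h.vacuum with hχ
  have h1 : ⟪χ, h.transfer t₀ χ⟫_ℂ = 0 := by
    rw [hχ, transfer_chi h lab hw ht₀.le, ← osTrunc_eq_inner h lab hN hw, h0]
  have hT : h.transfer t χ = 0 := transfer_eq_zero_of_inner_transfer_eq_zero h ht₀ h1 ht
  rw [osTrunc_eq_inner h lab hN hu (tsupport_timeShiftTest_pos hw ht.le), ← transfer_chi h lab hw ht.le, ← hχ, hT,
    inner_zero_right]

/-! ## Ball form -/

/-- Time coordinate on a ball about `c e₀`: `c − ρ ≤ y⁰`. [folklore] -/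
theorem sub_le_apply_zero_of_mem_closedBall {c ρ : ℝ} {y : EuclideanSpace ℝ (Fin 4)}
    (hy : y ∈ closedBall (EuclideanSpace.single (0 : Fin 4) c) ρ) : c - ρ ≤ y 0 := by
  rw [mem_closedBall, dist_eq_norm] at hy
  have h1 := (PiLp.norm_apply_le (y - EuclideanSpace.single (0 : Fin 4) c) 0).trans hy
  rw [PiLp.sub_apply, PiLp.single_eq_same, Real.norm_eq_abs] at h1
  linarith [(abs_le.1 h1).1]

/-- A ball `B̄(c e₀, ρ)` with `ρ < c` lies in positive times. [folklore] -/
theorem closedBall_subset_pos {c ρ : ℝ} (h : ρ < c) :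
    closedBall (EuclideanSpace.single (0 : Fin 4) c) ρ ⊆ {y : (EuclideanSpace ℝ (Fin 4)) | 0 < y 0} :=
  fun _ hy => lt_of_lt_of_le (sub_pos.2 h) (sub_le_apply_zero_of_mem_closedBall hy)

/-- Time shifts move balls on the time axis: `supp w ⊆ B̄(c e₀, ρ) ⇒ supp w(· − t e₀) ⊆ B̄((c + t) e₀, ρ)`. [folklore] -/
theorem tsupport_timeShiftTest_subset_closedBall {w : 𝓢((EuclideanSpace ℝ (Fin 4)), ℝ)} {c ρ : ℝ}
    (hw : tsupport w ⊆ closedBall (EuclideanSpace.single (0 : Fin 4) c) ρ) (t : ℝ) :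
    tsupport (timeShiftTest 4 t w) ⊆ closedBall (EuclideanSpace.single (0 : Fin 4) (c + t)) ρ := by
  intro y hy
  have hK : IsClosed ((fun y : EuclideanSpace ℝ (Fin 4) => y - EuclideanSpace.single 0 t) ⁻¹'
      tsupport w) :=
    (isClosed_tsupport _).preimage (continuous_id.sub continuous_const)
  have hsub : Function.support (timeShiftTest 4 t w) ⊆
      (fun y : EuclideanSpace ℝ (Fin 4) => y - EuclideanSpace.single 0 t) ⁻¹' tsupport w := by
    intro z hz
    rw [Function.mem_support, timeShiftTest_apply] at hz
    exact subset_tsupport _ (Function.mem_support.2 hz)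
  have h1 : y - EuclideanSpace.single 0 t ∈ closedBall (EuclideanSpace.single (0 : Fin 4) c) ρ :=
    hw (closure_minimal hsub hK hy)
  rw [mem_closedBall, dist_eq_norm] at h1
  rw [mem_closedBall, dist_eq_norm]
  have e : y - EuclideanSpace.single (0 : Fin 4) (c + t) =
      y - EuclideanSpace.single 0 t - EuclideanSpace.single (0 : Fin 4) c := by
    ext i
    simp only [PiLp.sub_apply, PiLp.single_apply]
    split_ifs <;> ring
  rwa [e]

/-- **Propagation, ball form.** Let `T = osTrunc S lab` be the truncated OS form of a family with E2, translation
invariance on `⁰𝒮` and `𝔖₀ = 1`. Suppose `T(u, v) = 0` whenever `u ⊆ B̄(s₁ e₀, ρ)`, `v ⊆ B̄(s₂ e₀, ρ)` with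
`ρ < s₁`, `ρ < s₂`, `ρ ≤ (s₁ + s₂)/4` and the pair is FAR: `s₀ < (s₁ + s₂)/2`. Then `T(u, v) = 0` for all real `u, v`
supported in ONE axial ball `B̄(s e₀, ρ)`, `0 < ρ ≤ s/2`, however close to the origin. [folklore] -/
theorem osTrunc_eq_zero_of_far (h : OSReconstructionNoE1 S) (lab : ι) (hN : S.IsNormalized) (s₀ : ℝ)
    (hfar : ∀ (s₁ s₂ ρ : ℝ) (u v : 𝓢((EuclideanSpace ℝ (Fin 4)), ℝ)), 0 < ρ → ρ < s₁ → ρ < s₂ →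
      s₀ < (s₁ + s₂) / 2 → ρ ≤ (s₁ + s₂) / 4 →
      tsupport u ⊆ closedBall (EuclideanSpace.single (0 : Fin 4) s₁) ρ →
      tsupport v ⊆ closedBall (EuclideanSpace.single (0 : Fin 4) s₂) ρ → osTrunc S lab u v = 0)
    {s ρ : ℝ} (hρ : 0 < ρ) (hρs : ρ ≤ s / 2) {u v : 𝓢((EuclideanSpace ℝ (Fin 4)), ℝ)}
    (hu : tsupport u ⊆ closedBall (EuclideanSpace.single (0 : Fin 4) s) ρ)
    (hv : tsupport v ⊆ closedBall (EuclideanSpace.single (0 : Fin 4) s) ρ) :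
    osTrunc S lab u v = 0 := by
  have hs : 0 < s := by linarith
  have hρs' : ρ < s := by linarith
  -- pull `v` back by `ε = (s − ρ)/2`: `v = w(· − ε e₀)` with `w` still positive-time
  set ε : ℝ := (s - ρ) / 2 with hε
  have hε0 : 0 < ε := by rw [hε]; linarith
  set w : 𝓢((EuclideanSpace ℝ (Fin 4)), ℝ) := timeShiftTest 4 (-ε) v with hwdef
  have hwB : tsupport w ⊆ closedBall (EuclideanSpace.single (0 : Fin 4) (s + -ε)) ρ :=
    tsupport_timeShiftTest_subset_closedBall hv (-ε)
  have hw : tsupport w ⊆ {y : (EuclideanSpace ℝ (Fin 4)) | 0 < y 0} :=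
    hwB.trans (closedBall_subset_pos (by rw [hε]; linarith))
  have hvw : timeShiftTest 4 ε w = v := by
    rw [hwdef, timeShiftTest_timeShiftTest, add_neg_cancel, timeShiftTest_zero']
  -- a far pair `(w, w(· − t₀ e₀))`
  set t₀ : ℝ := 2 * max s₀ 0 + 2 * ρ + 1 with ht₀
  have ht₀0 : 0 < t₀ := by
    have := le_max_right s₀ 0
    rw [ht₀]; linarith
  have hfar₀ : osTrunc S lab w (timeShiftTest 4 t₀ w) = 0 := by
    have h1 := le_max_left s₀ 0
    have h2 := le_max_right s₀ 0
    refine hfar (s + -ε) (s + -ε + t₀) ρ w _ hρ ?_ ?_ ?_ ?_ hwB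
      (tsupport_timeShiftTest_subset_closedBall hwB t₀)
    · rw [hε]; linarith
    · rw [hε]; linarith
    · rw [hε, ht₀]; linarith
    · rw [hε, ht₀]; linarith
  have hu' : tsupport u ⊆ {y : (EuclideanSpace ℝ (Fin 4)) | 0 < y 0} := hu.trans (closedBall_subset_pos hρs')
  have key := osTrunc_timeShift_eq_zero h lab hN hw ht₀0 hfar₀ hu' hε0
  rwa [hvw] at key

end OSForm

/-! ## Two-point form (real tensors on `⁰𝒮`) -/

section TwoPoint

/-- `![f 0, f 1] = f`. [folklore] -/
theorem vecCons_two_eta {α : Type*} (f : Fin 2 → α) : ![f 0, f 1] = f := by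
  funext i
  fin_cases i <;> rfl

/-- The real two-point tensor of `f` is THE tensor of `f` on `Fin 2`. [folklore] -/
theorem eq_tensor₂_of_isTensorOf {f : Fin 2 → 𝓢((EuclideanSpace ℝ (Fin 4)), ℝ)}
    {F : 𝓢((Fin 2 → (EuclideanSpace ℝ (Fin 4))), ℂ)} (hF : IsTensorOf F (fun i => ofRealTest (f i))) :
    F = tensor₂ (f 0) (f 1) := by
  refine hF.unique ?_
  have h := isTensorOf_tensor₂ (f 0) (f 1)
  rwa [vecCons_two_eta] at h

/-- A real one-point tensor witness is `tensor₁`. [folklore] -/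
theorem eq_tensor₁_of_isTensorOf {w : 𝓢((EuclideanSpace ℝ (Fin 4)), ℝ)}
    {F₀ : 𝓢((Fin 1 → (EuclideanSpace ℝ (Fin 4))), ℂ)} (hF₀ : IsTensorOf F₀ (fun _ => ofRealTest w)) :
    F₀ = tensor₁ w := by
  refine hF₀.unique fun x => ?_
  rw [tensor₁_apply]
  simp

/-- The time translate of a real two-point tensor is the tensor of the time shifts. [folklore] -/
theorem translateMulti_timeVec_tensor₂ (t : ℝ) (u v : 𝓢((EuclideanSpace ℝ (Fin 4)), ℝ)) :
    translateMulti (timeVec t) (tensor₂ u v) = tensor₂ (timeShiftTest 4 t u) (timeShiftTest 4 t v) := by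
  ext x
  rw [translateMulti_apply, tensor₂_apply, tensor₂_apply, timeShiftTest_apply, timeShiftTest_apply]

/-- Time reflection of a shifted ball: `supp u ⊆ B̄(c e₀, ρ) ⇒ supp (u ∘ θ) ⊆ B̄(−c e₀, ρ)`. [folklore] -/
theorem tsupport_thetaTest_subset_closedBall {u : 𝓢((EuclideanSpace ℝ (Fin 4)), ℝ)} {c ρ : ℝ}
    (hu : tsupport u ⊆ closedBall (EuclideanSpace.single (0 : Fin 4) c) ρ) :
    tsupport (thetaTest 4 u) ⊆ closedBall (EuclideanSpace.single (0 : Fin 4) (-c)) ρ := by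
  intro y hy
  have hK : IsClosed ((timeReflection 4) ⁻¹' tsupport u) :=
    (isClosed_tsupport _).preimage (timeReflection 4).continuous
  have hsub : Function.support (thetaTest 4 u) ⊆ (timeReflection 4) ⁻¹' tsupport u := by
    intro z hz
    rw [Function.mem_support, thetaTest_apply] at hz
    exact subset_tsupport _ (Function.mem_support.2 hz)
  have h1 : timeReflection 4 y ∈ closedBall (EuclideanSpace.single (0 : Fin 4) c) ρ :=
    hu (closure_minimal hsub hK hy)
  rw [mem_closedBall, dist_eq_norm] at h1
  rw [mem_closedBall, dist_eq_norm]
  have e : timeReflection 4 y - EuclideanSpace.single (0 : Fin 4) c =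
      timeReflection 4 (y - EuclideanSpace.single (0 : Fin 4) (-c)) := by
    ext i
    simp only [PiLp.sub_apply, timeReflection_apply, PiLp.single_apply]
    split_ifs <;> ring
  rwa [e, LinearIsometryEquiv.norm_map] at h1

end TwoPoint

end AxialPropagation

open AxialPropagation in
/-- **`TruncatedAxialPropagation`** (registered sub-goal). For a one-species Schwinger family `S₁` on `ℝ⁴` with E2,
translation invariance on `⁰𝒮` and `𝔖₀ = 1`: if the truncated two-point function vanishes on every REAL tensor pair
supported in the far-separated axial balls `B̄(∓s e₀, ρ)`, `s₀ < s`, `0 < ρ ≤ s/2` (`𝔖₂(f₀ ⊗ f₁) = 𝔖₁(f₀)𝔖₁(f₁)`), then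
it vanishes on all such pairs with `0 < s`. Reflection positivity makes `t ↦ 𝔖₂^T(θw ⊗ w_t) = ⟪χ_w, e^{−tH}χ_w⟫` the
expectation of a positive contraction semigroup, which cannot vanish at one time without vanishing at all positive times
(halving + semigroup law); Cauchy–Schwarz and translation invariance do the rest. [folklore] -/
theorem TruncatedAxialPropagation : open Literature.MathematicalPhysics.QuantumLattice Literature.MathematicalPhysics.AQFT in ∀ (S₁ : SchwingerFamily (EuclideanSpace ℝ (Fin 4))), S₁.toLabelled.IsReflectionPositive → (∀ (n : ℕ) (a : (EuclideanSpace ℝ (Fin 4))) (F : SchwartzMap (Fin n → (EuclideanSpace ℝ (Fin 4))) ℂ), IsOffDiagonal F → S₁ n (translateMulti a F) = S₁ n F) → S₁.toLabelled.IsNormalized → ∀ s₀ : ℝ, (∀ (s ρ : ℝ), s₀ < s → 0 < ρ → ρ ≤ s / 2 → ∀ (f : Fin 2 → SchwartzMap (EuclideanSpace ℝ (Fin 4)) ℝ) (F : SchwartzMap (Fin 2 → (EuclideanSpace ℝ (Fin 4))) ℂ) (F₀ F₁ : SchwartzMap (Fin 1 → (EuclideanSpace ℝ (Fin 4))) ℂ),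 IsTensorOf F (fun i => ofRealTest (f i)) → IsTensorOf F₀ (fun _ => ofRealTest (f 0)) → IsTensorOf F₁ (fun _ => ofRealTest (f 1)) → tsupport ((f 0 : SchwartzMap (EuclideanSpace ℝ (Fin 4)) ℝ) : (EuclideanSpace ℝ (Fin 4)) → ℝ) ⊆ Metric.closedBall (EuclideanSpace.single (0 : Fin 4) (-s)) ρ → tsupport ((f 1 : SchwartzMap (EuclideanSpace ℝ (Fin 4)) ℝ) : (EuclideanSpace ℝ (Fin 4)) → ℝ) ⊆ Metric.closedBall (EuclideanSpace.single (0 : Fin 4) s) ρ → S₁ 2 F = S₁ 1 F₀ * S₁ 1 F₁) → ∀ (s ρ : ℝ), 0 < s → 0 < ρ → ρ ≤ s / 2 → ∀ (f : Fin 2 → SchwartzMap (EuclideanSpace ℝ (Fin 4)) ℝ) (F : SchwartzMap (Fin 2 → (EuclideanSpace ℝ (Fin 4))) ℂ) (F₀ F₁ : SchwartzMap (Fin 1 → (EuclideanSpace ℝ (Fin 4))) ℂ), IsTensorOf F (fun i => ofRealTest (f i)) → IsTensorOf F₀ (fun _ => ofRealTest (f 0)) → IsTensorOf F₁ (fun _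 => ofRealTest (f 1)) → tsupport ((f 0 : SchwartzMap (EuclideanSpace ℝ (Fin 4)) ℝ) : (EuclideanSpace ℝ (Fin 4)) → ℝ) ⊆ Metric.closedBall (EuclideanSpace.single (0 : Fin 4) (-s)) ρ → tsupport ((f 1 : SchwartzMap (EuclideanSpace ℝ (Fin 4)) ℝ) : (EuclideanSpace ℝ (Fin 4)) → ℝ) ⊆ Metric.closedBall (EuclideanSpace.single (0 : Fin 4) s) ρ → S₁ 2 F = S₁ 1 F₀ * S₁ 1 F₁ := by
  intro S₁ hE2 htr hN s₀ hfar s ρ hs hρ hρs f F F₀ F₁ hF hF₀ hF₁ h0 h1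
  have h : OSReconstructionNoE1 S₁.toLabelled := ⟨hE2, fun n _ a G hG => htr n a G hG⟩
  -- two-point values of real tensors as the truncated OS form
  have key : ∀ (u v : 𝓢((EuclideanSpace ℝ (Fin 4)), ℝ)),
      osTrunc S₁.toLabelled () (thetaTest 4 u) v =
        S₁ 2 (tensor₂ u v) - S₁ 1 (tensor₁ u) * S₁ 1 (tensor₁ v) := by
    intro u v
    exact osTrunc_thetaTest S₁.toLabelled () u v
  -- (i) the far hypothesis in OS-form with two times
  have hfarOS : ∀ (s₁ s₂ ρ : ℝ) (u v : 𝓢((EuclideanSpace ℝ (Fin 4)), ℝ)), 0 < ρ → ρ < s₁ → ρ < s₂ →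
      s₀ < (s₁ + s₂) / 2 → ρ ≤ (s₁ + s₂) / 4 →
      tsupport u ⊆ closedBall (EuclideanSpace.single (0 : Fin 4) s₁) ρ →
      tsupport v ⊆ closedBall (EuclideanSpace.single (0 : Fin 4) s₂) ρ → osTrunc S₁.toLabelled () u v = 0 := by
    intro s₁ s₂ ρ' u v hρ' hρ1 hρ2 hfar' hρ4 hu hv
    -- translate the pair `(θu ⊆ B̄(−s₁e₀), v ⊆ B̄(s₂e₀))` by `c e₀`, `c = (s₁ − s₂)/2`, to the symmetric position
    set c : ℝ := (s₁ - s₂) / 2 with hc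
    set S : ℝ := (s₁ + s₂) / 2 with hS
    set f0 : 𝓢((EuclideanSpace ℝ (Fin 4)), ℝ) := timeShiftTest 4 c (thetaTest 4 u) with hf0
    set f1 : 𝓢((EuclideanSpace ℝ (Fin 4)), ℝ) := timeShiftTest 4 c v with hf1
    have hf0B : tsupport f0 ⊆ closedBall (EuclideanSpace.single (0 : Fin 4) (-S)) ρ' := by
      have := tsupport_timeShiftTest_subset_closedBall (tsupport_thetaTest_subset_closedBall hu) c
      have e : -s₁ + c = -S := by rw [hc, hS]; ring
      rwa [e] at this
    have hf1B : tsupport f1 ⊆ closedBall (EuclideanSpace.single (0 : Fin 4) S) ρ' := by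
      have := tsupport_timeShiftTest_subset_closedBall hv c
      have e : s₂ + c = S := by rw [hc, hS]; ring
      rwa [e] at this
    have hfar2 := hfar S ρ' hfar' hρ' (by rw [hS]; linarith) ![f0, f1] (tensor₂ f0 f1) (tensor₁ f0) (tensor₁ f1)
      (isTensorOf_tensor₂ f0 f1) (by intro x; rw [tensor₁_apply]; simp) (by intro x; rw [tensor₁_apply]; simp)
      hf0B hf1B
    -- undo the translation by translation invariance on `⁰𝒮`
    have hoff : IsOffDiagonal (tensor₂ (thetaTest 4 u) v) :=
      isOffDiagonal_of_halfSpaces (tsupport_thetaTest_neg (hu.trans (closedBall_subset_pos hρ1)))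
        (hv.trans (closedBall_subset_pos hρ2)) (isTensorOf_tensor₂ _ _)
    have e2 : S₁ 2 (tensor₂ f0 f1) = S₁ 2 (tensor₂ (thetaTest 4 u) v) := by
      rw [hf0, hf1, ← translateMulti_timeVec_tensor₂]
      exact htr _ _ _ hoff
    have e0 : S₁ 1 (tensor₁ f0) = S₁ 1 (tensor₁ (thetaTest 4 u)) := by
      rw [hf0, ← translateMulti_timeVec_tensor₁]
      exact htr _ _ _ (fun x hx => by obtain ⟨i, j, hij, -⟩ := hx; exact absurd (Subsingleton.elim i j) hij)
    have e1 : S₁ 1 (tensor₁ f1) = S₁ 1 (tensor₁ v) := by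
      rw [hf1, ← translateMulti_timeVec_tensor₁]
      exact htr _ _ _ (fun x hx => by obtain ⟨i, j, hij, -⟩ := hx; exact absurd (Subsingleton.elim i j) hij)
    have hk := key (thetaTest 4 u) v
    rw [thetaTest_involutive 4 u] at hk
    rw [hk, ← e2, ← e0, ← e1, sub_eq_zero]
    exact hfar2
  -- (ii) propagate, then return to the two-point form
  have hu : tsupport (thetaTest 4 (f 0)) ⊆ closedBall (EuclideanSpace.single (0 : Fin 4) s) ρ := by
    have := tsupport_thetaTest_subset_closedBall h0
    rwa [neg_neg] at this
  have hz := osTrunc_eq_zero_of_far h () hN s₀ hfarOS hρ hρs hu h1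
  rw [key, sub_eq_zero] at hz
  rw [eq_tensor₂_of_isTensorOf hF, eq_tensor₁_of_isTensorOf hF₀, eq_tensor₁_of_isTensorOf hF₁]
  exact hz

end Summit.QuantumFields.YangMills.Theorems.CurvatureKernel

end
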